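import Summits.ResolutionOfSingularities.ResolutionOfSingularities.Theorems.MarkedTransferCampaignW46TameConeRidge
import Literature.AlgebraicGeometry.Resolution.RidgeAlgebraDirects
import HarnessLib

/-!
# [OURS · L1 W4.6, rung (iv) «large characteristic»] The tangent cone of every state at every point is generated by
# its equations lying in Giraud's algebra of invariants of the RIDGE (Giraud's theorem (3), every characteristic); in
# regime (iv) of the TYPED procedure these invariants are the LINEAR Hasse–Schmidt coefficients — Hironaka's directrix
# theorem «the cone is defined by forms in the directrix variables» holds for the typed tangent cone
# (cell res-hironaka, LADDER-RESOLUTION rung L, D-0089; slot W4.6, seat res-L1-s46-pv-7 gen 4; host route MarkedTransfer,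
# `--supports stmt-ResolutionOfSingularities-16155 --as helper`)

HONEST FRAMING. Nothing here is a statement of H. Hironaka's manuscript (2017-03-23, [Hironaka2017]) and nothing here
asserts that any statement of it holds. OURS corollaries, over the shared typed-procedure module
`MarkedTransferCampaignW46TypedProcedure` (res-L1-type-o1: `CampaignW46.Regime.charGT`, `AmbientDatum`, `IdealExponent`
— typed CANDIDATE carriers used as definitions) and the TREE's cone vocabulary
(`Literature.AlgebraicGeometry.Resolution.initialForms c J μ` = `cl_μ(J)`; `ridge` / `ridgeIdeal` / `ridgeAlgebra`,
Giraud's ridge functor, its ideal and its algebra of invariants; `AddDirects I G` = "`I` is generated by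
`I ∩ K[G]`"; `linearHasseSet` = the linear Hasse–Schmidt coefficients), of this seat's Literature landing of gen 4:
`RidgeAlgebraDirects.lean` — GIRAUD 1975 §1.5 (3) «`I ∩ U` engendre l'idéal `I`» PROVED for every ideal over any
field. No premise of the manuscript, no FACT-LIST premise. AI review is weaker than expert review. No `sorry`, no new
definition; axioms standard.

## What this file adds to `TameConeRidge` (p505389: the ridge of the typed tangent cone is linear in regime (iv))

* EVERY characteristic (`span_initialForms_eq_span_inter_ridgeAlgebra`, `addDirects_initialForms_iff_forall_mem_ridge`,
  typed `span_tangentCone_stalk_eq_span_inter_ridgeAlgebra`): the ideal `⟨cl_μ(J)⟩ · κ[Y]` of the cone of the order-`μ`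
  initial forms is generated by its elements lying in Giraud's algebra of invariants `U = κ[additive forms of 𝔉]`
  of its ridge — `⟨cl_μ(J)⟩ = (⟨cl_μ(J)⟩ ∩ U) κ[Y]` — and, functorially, a closed additive subgroup `V(G)` of the tangent
  space translates the cone into itself iff the cone is defined by equations in `κ[G]` (Giraud's (3) verbatim);
* REGIME (iv), `E.b < p` (`addDirects_initialForms_linearHasseSet(_of_lt_char)`, typed
  `addDirects_tangentCone_stalk_linearHasseSet`, `_of_le`): the invariants are generated by the LINEAR Hasse–Schmidt
  coefficients of the initial forms (p504568/p505389), so the tangent cone ideal `⟨cl_b(J_ξ)⟩` at every point `ξ` of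
  every state is generated by forms in the linear Hasse coefficients, i.e. by forms on the quotient `T_ξ/Dir` —
  Hironaka's characteristic-zero DIRECTRIX THEOREM for the typed tangent cone, the last of the cone-level statements
  of rung (iv) (Dir, `τ`, Rid, edge datum: p483854, p505389, p510501; generation: this file).

## References (context; nothing is cited as a premise)

* this seat's `RidgeAlgebraDirects.lean` (Giraud 1975 §1.5 (3)), p504568 `RidgeEqualDegree.lean`, p505389 `TameConeRidge`.
* J. Giraud, Ann. Sci. ÉNS 8 (1975), §1.5 (3) p.204. [cite: Giraud1975, §1.5 (3)]
* J. Berthomieu, P. Hivert, H. Mourtada, Contemp. Math. 521 (2010), Def. 1.2, Cor. 2.12. [cite: BerthomieuHivertMourtada2010, Cor. 2.12]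
-/

noncomputable section

set_option linter.dupNamespace false -- mandated namespace of this single-conjunct summit

open CategoryTheory AlgebraicGeometry TopologicalSpace IsLocalRing

namespace Summit.ResolutionOfSingularities.ResolutionOfSingularities.Theorems
namespace CampaignW46
namespace ConeRidgeDirects

open MvPolynomial
open Literature.AlgebraicGeometry.Resolution
open Literature.AlgebraicGeometry.Hironaka2017.S02Preliminaries
open Literature.AlgebraicGeometry.Hironaka2017.Datum
open Literature.RingTheory.MvPolynomial (isHomogeneousIdeal_span_of_isHomogeneous)

universe u

/-! ## Ring level: the cone of the initial forms of an ideal of a local ring -/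

section LocalRing

variable {R : Type u} [CommRing R] [IsLocalRing R] {d : ℕ} (c : Fin d → R)

/-- [OURS · L1 W4.6 (iv); NOT a statement of the manuscript] **Every characteristic (Giraud's theorem (3)): the ideal
of the cone `V(cl_μ(J))` is generated by its elements lying in the algebra of invariants `U = κ[ridgeForm]` of its
ridge** — `⟨cl_μ(J)⟩ = (⟨cl_μ(J)⟩ ∩ U) κ[Y]` (`RidgeAlgebraDirects.eq_span_inter_ridgeAlgebra`; the ideal spanned by
forms of one degree is homogeneous). [folklore] -/
theorem span_initialForms_eq_span_inter_ridgeAlgebra (p : ℕ) [ExpChar (ResidueField R) p] (J : Ideal R) (μ : ℕ) :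
    Ideal.span (initialForms c J μ : Set (MvPolynomial (Fin d) (ResidueField R))) =
      Ideal.span ((Ideal.span (initialForms c J μ : Set (MvPolynomial (Fin d) (ResidueField R))) :
          Set (MvPolynomial (Fin d) (ResidueField R))) ∩
        (ridgeAlgebra p (Ideal.span (initialForms c J μ : Set (MvPolynomial (Fin d) (ResidueField R)))) :
          Set (MvPolynomial (Fin d) (ResidueField R)))) :=
  eq_span_inter_ridgeAlgebra
    (isHomogeneousIdeal_span_of_isHomogeneous fun _ hG => ⟨μ, isHomogeneous_of_mem_initialForms c hG⟩)

/-- [OURS · L1 W4.6 (iv); NOT a statement of the manuscript] **Every characteristic: the algebra generated by the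
additive forms of the ridge ideal directs the cone ideal** (`AddDirects`). [folklore] -/
theorem addDirects_initialForms_range_ridgeForm (p : ℕ) [ExpChar (ResidueField R) p] (J : Ideal R) (μ : ℕ) :
    AddDirects (Ideal.span (initialForms c J μ : Set (MvPolynomial (Fin d) (ResidueField R))))
      (Set.range (ridgeForm p (Ideal.span (initialForms c J μ : Set (MvPolynomial (Fin d) (ResidueField R)))))) :=
  addDirects_range_ridgeForm
    (isHomogeneousIdeal_span_of_isHomogeneous fun _ hG => ⟨μ, isHomogeneous_of_mem_initialForms c hG⟩)

/-- [OURS · L1 W4.6 (iv); NOT a statement of the manuscript] **Every characteristic, Giraud's (3) verbatim for the cone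
of the initial forms**: for a set `G` of additive homogeneous polynomials on the tangent space, the closed subgroup
`V(G)` translates the cone `V(cl_μ(J)) ×_κ k'` into itself for every `κ`-algebra `k'` iff the cone ideal is generated
by its equations in `κ[G]`. [folklore] -/
theorem addDirects_initialForms_iff_forall_mem_ridge (J : Ideal R) (μ : ℕ)
    {G : Set (MvPolynomial (Fin d) (ResidueField R))} (hG : ∀ g ∈ G, IsAdditive g ∧ ∃ q, g.IsHomogeneous q) :
    AddDirects (Ideal.span (initialForms c J μ : Set (MvPolynomial (Fin d) (ResidueField R)))) G ↔
      ∀ (k' : Type u) [CommRing k'] [Algebra (ResidueField R) k'] (v : Fin d → k'), (∀ g ∈ G, aeval v g = 0) →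
        v ∈ ridge k' (Ideal.span (initialForms c J μ : Set (MvPolynomial (Fin d) (ResidueField R)))) :=
  addDirects_iff_forall_mem_ridge hG

/-- [OURS · L1 W4.6 (iv); NOT a statement of the manuscript] **Tame order: the cone ideal `⟨cl_μ(J)⟩` is generated by
forms in the LINEAR Hasse–Schmidt coefficients of the initial forms** (Hironaka's directrix theorem for the cone:
`(I ∩ κ[T]) κ[Y] = I` with `T` spanned by the linear Hasse coefficients), whenever `1, …, μ` are non-zero in `κ` — by
Giraud's (3) applied to `𝔉 = ⟨linearHasseSet⟩` (p504568 `ridgeIdeal_span_eq_span_linearHasseSet`). [folklore] -/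
theorem addDirects_initialForms_linearHasseSet (J : Ideal R) {μ : ℕ}
    (hchar : ∀ m : ℕ, 1 ≤ m → m ≤ μ → (m : ResidueField R) ≠ 0) :
    AddDirects (Ideal.span (initialForms c J μ : Set (MvPolynomial (Fin d) (ResidueField R))))
      (linearHasseSet (initialForms c J μ : Set (MvPolynomial (Fin d) (ResidueField R))) μ) := by
  have hG : ∀ g ∈ (initialForms c J μ : Set (MvPolynomial (Fin d) (ResidueField R))), g.IsHomogeneous μ :=
    fun _ hG => isHomogeneous_of_mem_initialForms c hG
  refine addDirects_of_ridgeIdeal_le_span (fun l hl => ?_) (ridgeIdeal_span_eq_span_linearHasseSet hG hchar).le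
  have h1 := isHomogeneous_one_of_mem_linearHasseSet hG hl
  exact ⟨isAdditive_of_isHomogeneous_one h1, 1, h1⟩

/-- [OURS · L1 W4.6 (iv)] The same in residue characteristic `p > μ` (the local ring itself of characteristic `p`).
[folklore] -/
theorem addDirects_initialForms_linearHasseSet_of_lt_char (p : ℕ) [Fact p.Prime] [CharP R p] (J : Ideal R)
    {μ : ℕ} (hμ : μ < p) :
    AddDirects (Ideal.span (initialForms c J μ : Set (MvPolynomial (Fin d) (ResidueField R))))
      (linearHasseSet (initialForms c J μ : Set (MvPolynomial (Fin d) (ResidueField R))) μ) :=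
  haveI := TameRegime.charP_residueField (R := R) p
  addDirects_initialForms_linearHasseSet c J (TamePolar.natCast_ne_zero_of_lt_char p hμ)

end LocalRing

/-! ## Typed level: every regime, and regime (iv) of the shared module (`E.b < p`) -/

section Typed

variable {n : ℕ} {p : ℕ} [Fact p.Prime] {K : Type u} [Field K] [CharP K p]

/-- [OURS · L1 W4.6 (iv); NOT a statement of the manuscript] **Every regime, every point (Giraud's (3)): the ideal of the
tangent cone `V(cl_b(J_ξ))` of a state `(A, E)` at a point `ξ` whose local ring has characteristic `p` is generated by
its elements in Giraud's algebra of invariants `U = κ(ξ)[additive p-forms of 𝔉]` of the ridge.** [folklore] -/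
theorem span_tangentCone_stalk_eq_span_inter_ridgeAlgebra (A : AmbientDatum p K) (E : IdealExponent A.Z) (ξ : A.Z)
    (hp : CharP (A.Z.presheaf.stalk ξ) p) {d : ℕ} (c : Fin d → A.Z.presheaf.stalk ξ) :
    Ideal.span (initialForms c (stalkIdeal E.J ξ) E.b :
        Set (MvPolynomial (Fin d) (ResidueField (A.Z.presheaf.stalk ξ)))) =
      Ideal.span ((Ideal.span (initialForms c (stalkIdeal E.J ξ) E.b :
            Set (MvPolynomial (Fin d) (ResidueField (A.Z.presheaf.stalk ξ)))) :
          Set (MvPolynomial (Fin d) (ResidueField (A.Z.presheaf.stalk ξ)))) ∩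
        (ridgeAlgebra p (Ideal.span (initialForms c (stalkIdeal E.J ξ) E.b :
            Set (MvPolynomial (Fin d) (ResidueField (A.Z.presheaf.stalk ξ))))) :
          Set (MvPolynomial (Fin d) (ResidueField (A.Z.presheaf.stalk ξ))))) := by
  haveI := hp
  haveI := TameRegime.charP_residueField (R := A.Z.presheaf.stalk ξ) p
  haveI : ExpChar (ResidueField (A.Z.presheaf.stalk ξ)) p := ExpChar.prime Fact.out
  exact span_initialForms_eq_span_inter_ridgeAlgebra c p (stalkIdeal E.J ξ) E.b

/-- [OURS · L1 W4.6 (iv); NOT a statement of the manuscript] **Regime (iv): the tangent cone of every state at every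
point is defined by forms in the directrix variables.** For a state `(A, E)` in `Regime.charGT n (fun _ b ↦ b)`
(`E.b < p`) and a point `ξ` whose local ring has characteristic `p`: the ideal `⟨cl_b(J_ξ)⟩` is generated by its
intersection with `κ(ξ)[linear Hasse–Schmidt coefficients of cl_b(J_ξ)]` (= `κ(ξ)[T]`, `T` the directrix space,
p506201) — Hironaka's characteristic-zero directrix theorem, holding for the typed tangent cone throughout regime (iv).
[folklore] -/
theorem addDirects_tangentCone_stalk_linearHasseSet (A : AmbientDatum p K) (E : IdealExponent A.Z)
    (hE : Regime.charGT (p := p) (K := K) n (fun _ b => b) A E) (ξ : A.Z) (hp : CharP (A.Z.presheaf.stalk ξ) p)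
    {d : ℕ} (c : Fin d → A.Z.presheaf.stalk ξ) :
    AddDirects (Ideal.span (initialForms c (stalkIdeal E.J ξ) E.b :
        Set (MvPolynomial (Fin d) (ResidueField (A.Z.presheaf.stalk ξ)))))
      (linearHasseSet (initialForms c (stalkIdeal E.J ξ) E.b :
        Set (MvPolynomial (Fin d) (ResidueField (A.Z.presheaf.stalk ξ)))) E.b) :=
  haveI := hp
  addDirects_initialForms_linearHasseSet_of_lt_char c p (stalkIdeal E.J ξ) hE

/-- [OURS · L1 W4.6 (iv)] Monotonicity in the threshold (p471737 `Regime.charGT_of_le`): the directrix theorem for the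
typed tangent cone holds in every regime `Regime.charGT n f` with `(fun _ b ↦ b) ≤ f` (e.g. V5's `fun _ b ↦ b !`).
[folklore] -/
theorem addDirects_tangentCone_stalk_linearHasseSet_of_le {f : ℕ → ℕ → ℕ} (hf : (fun _ b : ℕ => b) ≤ f)
    (A : AmbientDatum p K) (E : IdealExponent A.Z) (hE : Regime.charGT (p := p) (K := K) n f A E) (ξ : A.Z)
    (hp : CharP (A.Z.presheaf.stalk ξ) p) {d : ℕ} (c : Fin d → A.Z.presheaf.stalk ξ) :
    AddDirects (Ideal.span (initialForms c (stalkIdeal E.J ξ) E.b :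
        Set (MvPolynomial (Fin d) (ResidueField (A.Z.presheaf.stalk ξ)))))
      (linearHasseSet (initialForms c (stalkIdeal E.J ξ) E.b :
        Set (MvPolynomial (Fin d) (ResidueField (A.Z.presheaf.stalk ξ)))) E.b) :=
  addDirects_tangentCone_stalk_linearHasseSet A E (Regime.charGT_of_le (fun b => hf n b) A E hE) ξ hp c

end Typed

end ConeRidgeDirects
end CampaignW46
end Summit.ResolutionOfSingularities.ResolutionOfSingularities.Theorems

end
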